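import Mathlib
import Summits.AtomisticToContinuum.HydrodynamicLimit.Theorems.ImplosionDichotomyDenseExcursionSonicCentreContentInnerPoint
import Summits.AtomisticToContinuum.HydrodynamicLimit.Theorems.ImplosionDichotomyDenseExcursionSonicCentreContentInnerIneq

/-!
# The energy differential inequalities of the centre problem at a point (regions I and II)
# (crux `DenseExcursion`, line `sonic-cavity-renewal`, brick for `centreContent_of_tube`)

Helper file (`--supports stmt-AtomisticToContinuum-12586`, line lead a2, stub-worker W3 for `centreContent_of_tube`).

Combines the point package (`…SonicCentreContentInnerPoint.inner_point`), the quadratic identities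
(`…SonicCentreContentInnerSystem.dE_alg`, `dEm_alg`, `dEp_alg`, `dN_alg`, `hasDerivAt_norm_sq_complex`) and the arithmetic
(`…SonicCentreContentInnerIneq`) into the differential inequalities of the four real functions of `y`
`N = ‖eʸŵ‖²/9 + ‖eʸŝ‖²`, `E = ‖v‖² + ‖z‖²`, `‖v − z‖²`, `‖v + z‖²` (`v = eʸŝ + (Λk/3)eʸŵ`, `z = Λk·eʸŝ`, `k = −S/((W−1)² − S²)`),
stated with `deriv` so that the barrier lemmas of `…SonicCentreContentInnerBarrier` apply verbatim:
`inner_pointII` (registered helper; region II `1/‖Λ‖ ≤ eʸ ≤ 1/50`) and `inner_pointI` (region I `eʸ ≤ 1/‖Λ‖`).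
-/

noncomputable section

open Set

namespace Summit.AtomisticToContinuum.HydrodynamicLimit.Theorems.SonicCavityRenewal

open Summit.AtomisticToContinuum.HydrodynamicLimit.Theorems.R2OneModeTwoConditions

/-- **Registered helper `inner_pointII`: THE ENERGY INEQUALITIES AT A POINT OF REGION II** (`1/‖Λ‖ ≤ eʸ ≤ 1/50`). For a
smooth mode of a tube profile on the pinned window with `−1/4 < Re Λ ≤ 3`, `‖Λ‖ ≥ 1000`, the three energies of the
travelling-wave pair — total `E = ‖v‖² + ‖z‖²`, regular family `‖v − z‖²`, degenerate family `‖v + z‖²` (explicit real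
functions of `y`) — are differentiable at `y` with `E′ ≤ (8.64ρ + 11ρ² + 4m₂)E`, `(‖v−z‖²)′ ≤ (0.72ρ + 11ρ² + (7/5)m₂)‖v−z‖² + (10/7)m₂E`,
`(‖v+z‖²)′ ≥ −(0.72ρ + 0.92ρ² + (7/5)m₂)‖v+z‖² − (10/7)m₂E`, `m₂ = 5.16ρ + 18.5ρ²`, `ρ = eʸ` (point package + `dE_alg`/
`dEm_alg`/`dEp_alg` + `inner_regionII_ineq`). [folklore] -/
theorem inner_pointII : ∀ {r : ℝ} {W S : ℝ → ℝ} {Λ : ℂ} {ŵ ŝ : ℝ → ℂ}, 17307 / 15625 ≤ r → r ≤ 89409 / 80000 → IsMonatomicProfile r W S → CavityTube r W S → -(1 / 4 : ℝ) < Λ.re → Λ.re ≤ 3 → 1000 ≤ ‖Λ‖ → ∀ {y : ℝ}, Real.exp y ≤ 1 / 50 → DifferentiableAt ℝ ŵ y → DifferentiableAt ℝ ŝ y → (Λ * ŵ y = linW r W S ŵ ŝ y ∧ Λ * ŝ y = linS r W S ŵ ŝ y) → 1 ≤ Real.exp y * ‖Λ‖ → DifferentiableAt ℝ (fun t => ‖(((Real.exp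 t : ℂ) * ŝ t) + (Λ * ((-S t / ((W t - 1) ^ 2 - S t ^ 2) : ℝ) : ℂ) / 3) * ((Real.exp t : ℂ) * ŵ t))‖ ^ 2 + ‖(Λ * ((-S t / ((W t - 1) ^ 2 - S t ^ 2) : ℝ) : ℂ) * ((Real.exp t : ℂ) * ŝ t))‖ ^ 2) y ∧ DifferentiableAt ℝ (fun t => ‖(((Real.exp t : ℂ) * ŝ t) + (Λ * ((-S t / ((W t - 1) ^ 2 - S t ^ 2) : ℝ) : ℂ) / 3) * ((Real.exp t : ℂ) * ŵ t)) - (Λ * ((-S t / ((W t - 1) ^ 2 - S t ^ 2) : ℝ) : ℂ) * ((Real.exp t : ℂ) * ŝ t))‖ ^ 2) y ∧ DifferentiableAt ℝ (fun t => ‖(((Real.exp t : ℂ) * ŝ t) + (Λ * ((-S t / ((W t - 1) ^ 2 - S t ^ 2) : ℝ) : ℂ) / 3) * ((Real.exp t : ℂ) * ŵ t)) + (Λ * ((-S t / ((W t - 1) ^ 2 - S t ^ 2) : ℝ) : ℂ) * ((Real.exp t : ℂ) * ŝ t))‖ ^ 2) y ∧ deriv (fun t => ‖(((Real.exp t : ℂ)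 * ŝ t) + (Λ * ((-S t / ((W t - 1) ^ 2 - S t ^ 2) : ℝ) : ℂ) / 3) * ((Real.exp t : ℂ) * ŵ t))‖ ^ 2 + ‖(Λ * ((-S t / ((W t - 1) ^ 2 - S t ^ 2) : ℝ) : ℂ) * ((Real.exp t : ℂ) * ŝ t))‖ ^ 2) y ≤ (864 / 100 * Real.exp y + 11 * Real.exp y ^ 2 + 4 * (516 / 100 * Real.exp y + 185 / 10 * Real.exp y ^ 2)) * (fun t => ‖(((Real.exp t : ℂ) * ŝ t) + (Λ * ((-S t / ((W t - 1) ^ 2 - S t ^ 2) : ℝ) : ℂ) / 3) * ((Real.exp t : ℂ) * ŵ t))‖ ^ 2 + ‖(Λ * ((-S t / ((W t - 1) ^ 2 - S t ^ 2) : ℝ) : ℂ) * ((Real.exp t : ℂ) * ŝ t))‖ ^ 2) y ∧ deriv (fun t => ‖(((Real.exp t : ℂ) * ŝ t) + (Λ * ((-S t / ((W t - 1) ^ 2 - S t ^ 2) : ℝ) : ℂ) / 3) * ((Real.exp t : ℂ) * ŵ t)) - (Λ * ((-S t / ((W t - 1) ^ 2 - S t ^ 2) : ℝ) : ℂ) *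 ((Real.exp t : ℂ) * ŝ t))‖ ^ 2) y ≤ (72 / 100 * Real.exp y + 11 * Real.exp y ^ 2 + 7 / 5 * (516 / 100 * Real.exp y + 185 / 10 * Real.exp y ^ 2)) * (fun t => ‖(((Real.exp t : ℂ) * ŝ t) + (Λ * ((-S t / ((W t - 1) ^ 2 - S t ^ 2) : ℝ) : ℂ) / 3) * ((Real.exp t : ℂ) * ŵ t)) - (Λ * ((-S t / ((W t - 1) ^ 2 - S t ^ 2) : ℝ) : ℂ) * ((Real.exp t : ℂ) * ŝ t))‖ ^ 2) y + 10 / 7 * (516 / 100 * Real.exp y + 185 / 10 * Real.exp y ^ 2) * (fun t => ‖(((Real.exp t : ℂ) * ŝ t) + (Λ * ((-S t / ((W t - 1) ^ 2 - S t ^ 2) : ℝ) : ℂ) / 3) * ((Real.exp t : ℂ) * ŵ t))‖ ^ 2 + ‖(Λ * ((-S t / ((W t - 1) ^ 2 - S t ^ 2) : ℝ) : ℂ) * ((Real.exp t : ℂ) * ŝ t))‖ ^ 2) y ∧ -((72 / 100 * Real.exp y + 92 / 100 * Real.exp y ^ 2 + 7 / 5 * (516 / 100 * Real.exp y + 185 /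 10 * Real.exp y ^ 2)) * (fun t => ‖(((Real.exp t : ℂ) * ŝ t) + (Λ * ((-S t / ((W t - 1) ^ 2 - S t ^ 2) : ℝ) : ℂ) / 3) * ((Real.exp t : ℂ) * ŵ t)) + (Λ * ((-S t / ((W t - 1) ^ 2 - S t ^ 2) : ℝ) : ℂ) * ((Real.exp t : ℂ) * ŝ t))‖ ^ 2) y) - 10 / 7 * (516 / 100 * Real.exp y + 185 / 10 * Real.exp y ^ 2) * (fun t => ‖(((Real.exp t : ℂ) * ŝ t) + (Λ * ((-S t / ((W t - 1) ^ 2 - S t ^ 2) : ℝ) : ℂ) / 3) * ((Real.exp t : ℂ) * ŵ t))‖ ^ 2 + ‖(Λ * ((-S t / ((W t - 1) ^ 2 - S t ^ 2) : ℝ) : ℂ) * ((Real.exp t : ℂ) * ŝ t))‖ ^ 2) y ≤ deriv (fun t => ‖(((Real.exp t : ℂ) * ŝ t) + (Λ * ((-S t / ((W t - 1) ^ 2 - S t ^ 2) : ℝ) : ℂ) / 3) * ((Real.exp t : ℂ) * ŵ t)) + (Λ * ((-S t / ((W t - 1) ^ 2 - S t ^ 2) : ℝ) : ℂ) * ((Real.exp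 t : ℂ) * ŝ t))‖ ^ 2) y := by
  intro r W S Λ ŵ ŝ hr₁ hr₂ hP hT hre₁ hre₂ hL y hy hŵ hŝ hmode hρL
  obtain ⟨Θ, Ev, Ez, A, Bc, Cc, Dc, hU, hS, hv, hz, hEv, hEz, hΘ, hκre, hm, hp, ht₁, ht₂, hAb, hBb, hCb, hDb⟩ :=
    inner_point hr₁ hr₂ hP hT hre₁ hre₂ hy hŵ hŝ hmode
  have hρ : 0 < Real.exp y := Real.exp_pos y
  have hUid : Λ * ((-S y / ((W y - 1) ^ 2 - S y ^ 2) : ℝ) : ℂ) / 3 * ((Real.exp y : ℂ) * ŵ y) = (((Real.exp y : ℂ) * ŝ y) + (Λ * ((-S y / ((W y - 1) ^ 2 - S y ^ 2) : ℝ) : ℂ) / 3) * ((Real.exp y : ℂ) * ŵ y)) - ((Real.exp y : ℂ) * ŝ y) := by ring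
  have dE : HasDerivAt (fun t => ‖(((Real.exp t : ℂ) * ŝ t) + (Λ * ((-S t / ((W t - 1) ^ 2 - S t ^ 2) : ℝ) : ℂ) / 3) * ((Real.exp t : ℂ) * ŵ t))‖ ^ 2 + ‖(Λ * ((-S t / ((W t - 1) ^ 2 - S t ^ 2) : ℝ) : ℂ) * ((Real.exp t : ℂ) * ŝ t))‖ ^ 2) _ y := (hasDerivAt_norm_sq_complex hv).add (hasDerivAt_norm_sq_complex hz)
  have dM : HasDerivAt (fun t => ‖(((Real.exp t : ℂ) * ŝ t) + (Λ * ((-S t / ((W t - 1) ^ 2 - S t ^ 2) : ℝ) : ℂ) / 3) * ((Real.exp t : ℂ) * ŵ t)) - (Λ * ((-S t / ((W t - 1) ^ 2 - S t ^ 2) : ℝ) : ℂ) * ((Real.exp t : ℂ) * ŝ t))‖ ^ 2) _ y := hasDerivAt_norm_sq_complex (hv.sub hz)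
  have dP : HasDerivAt (fun t => ‖(((Real.exp t : ℂ) * ŝ t) + (Λ * ((-S t / ((W t - 1) ^ 2 - S t ^ 2) : ℝ) : ℂ) / 3) * ((Real.exp t : ℂ) * ŵ t)) + (Λ * ((-S t / ((W t - 1) ^ 2 - S t ^ 2) : ℝ) : ℂ) * ((Real.exp t : ℂ) * ŝ t))‖ ^ 2) _ y := hasDerivAt_norm_sq_complex (hv.add hz)
  have aE := dE_alg (((Real.exp y : ℂ) * ŝ y) + (Λ * ((-S y / ((W y - 1) ^ 2 - S y ^ 2) : ℝ) : ℂ) / 3) * ((Real.exp y : ℂ) * ŵ y)) (Λ * ((-S y / ((W y - 1) ^ 2 - S y ^ 2) : ℝ) : ℂ) * ((Real.exp y : ℂ) * ŝ y)) _ _ Θ (Λ * ((-S y / ((W y - 1) ^ 2 - S y ^ 2) : ℝ) : ℂ)) Ev Ez rfl rfl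
  have aM := dEm_alg (((Real.exp y : ℂ) * ŝ y) + (Λ * ((-S y / ((W y - 1) ^ 2 - S y ^ 2) : ℝ) : ℂ) / 3) * ((Real.exp y : ℂ) * ŵ y)) (Λ * ((-S y / ((W y - 1) ^ 2 - S y ^ 2) : ℝ) : ℂ) * ((Real.exp y : ℂ) * ŝ y)) _ _ Θ (Λ * ((-S y / ((W y - 1) ^ 2 - S y ^ 2) : ℝ) : ℂ)) Ev Ez rfl rfl
  have aP := dEp_alg (((Real.exp y : ℂ) * ŝ y) + (Λ * ((-S y / ((W y - 1) ^ 2 - S y ^ 2) : ℝ) : ℂ) / 3) * ((Real.exp y : ℂ) * ŵ y)) (Λ * ((-S y / ((W y - 1) ^ 2 - S y ^ 2) : ℝ) : ℂ) * ((Real.exp y : ℂ) * ŝ y)) _ _ Θ (Λ * ((-S y / ((W y - 1) ^ 2 - S y ^ 2) : ℝ) : ℂ)) Ev Ez rfl rfl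
  have ht1 : 1 ≤ ‖Λ * ((-S y / ((W y - 1) ^ 2 - S y ^ 2) : ℝ) : ℂ)‖ := hρL.trans ht₁
  obtain ⟨iE, iM, iP⟩ := inner_regionII_ineq (((Real.exp y : ℂ) * ŝ y) + (Λ * ((-S y / ((W y - 1) ^ 2 - S y ^ 2) : ℝ) : ℂ) / 3) * ((Real.exp y : ℂ) * ŵ y)) (Λ * ((-S y / ((W y - 1) ^ 2 - S y ^ 2) : ℝ) : ℂ) * ((Real.exp y : ℂ) * ŝ y)) ((Real.exp y : ℂ) * ŵ y) ((Real.exp y : ℂ) * ŝ y) Θ (Λ * ((-S y / ((W y - 1) ^ 2 - S y ^ 2) : ℝ) : ℂ)) Ev Ez (Real.exp y) ‖Λ‖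
    hρ hy hL ht1 ht₁ hρL hUid rfl hEv hEz hΘ hκre hm hp
  refine ⟨dE.differentiableAt, dM.differentiableAt, dP.differentiableAt, ?_, ?_, ?_⟩
  · beta_reduce; rw [dE.deriv, aE]; exact iE
  · beta_reduce; rw [dM.deriv, aM]; exact iM
  · beta_reduce; rw [dP.deriv, aP]; exact iP

/-- **THE ENERGY INEQUALITIES AT A POINT OF REGION I** (`eʸ ≤ 1/‖Λ‖`), given an a priori bound `N(y) ≤ N̄` for
`N = ‖𝒰‖²/9 + ‖𝒮‖²`: `N′ ≤ (11.22ρ + 21ρ²)N`, `E′ ≤ (12.36ρ + 44.5ρ²)E + (6.3ρ + 11.5ρ²)N̄`,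
`(‖v−z‖²)′ ≤ (7.02ρ + 33.5ρ²)‖v−z‖² + 22ρ²E + (6.3ρ + 11.5ρ²)N̄`, `(‖v+z‖²)′ ≥ −(7.02ρ + 23.42ρ²)‖v+z‖² − 22ρ²E − (6.3ρ + 11.5ρ²)N̄`
(point package + `dN_alg` + `inner_N_ineq` + `inner_regionI_ineq`). [folklore] -/
theorem inner_pointI {r : ℝ} {W S : ℝ → ℝ} {Λ : ℂ} {ŵ ŝ : ℝ → ℂ} (hr₁ : 17307 / 15625 ≤ r) (hr₂ : r ≤ 89409 / 80000)
    (hP : IsMonatomicProfile r W S) (hT : CavityTube r W S) (hre₁ : -(1 / 4 : ℝ) < Λ.re) (hre₂ : Λ.re ≤ 3)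
    (hL : 1000 ≤ ‖Λ‖) {y : ℝ} (hy : Real.exp y ≤ 1 / 50) (hŵ : DifferentiableAt ℝ ŵ y) (hŝ : DifferentiableAt ℝ ŝ y)
    (hmode : Λ * ŵ y = linW r W S ŵ ŝ y ∧ Λ * ŝ y = linS r W S ŵ ŝ y)
    (hρL : Real.exp y * ‖Λ‖ ≤ 1) {Nb : ℝ} (hNb : (fun t => ‖((Real.exp t : ℂ) * ŵ t)‖ ^ 2 / 9 + ‖((Real.exp t : ℂ) * ŝ t)‖ ^ 2) y ≤ Nb) :
    DifferentiableAt ℝ (fun t => ‖((Real.exp t : ℂ) * ŵ t)‖ ^ 2 / 9 + ‖((Real.exp t : ℂ) * ŝ t)‖ ^ 2) y ∧ DifferentiableAt ℝ (fun t => ‖(((Real.exp t : ℂ) * ŝ t) + (Λ * ((-S t / ((W t - 1) ^ 2 - S t ^ 2) : ℝ) : ℂ) / 3) * ((Real.exp t : ℂ) * ŵ t))‖ ^ 2 + ‖(Λ * ((-S t / ((W t - 1) ^ 2 - S t ^ 2) : ℝ) : ℂ) * ((Real.exp t : ℂ) * ŝ t))‖ ^ 2) y ∧ DifferentiableAt ℝ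 (fun t => ‖(((Real.exp t : ℂ) * ŝ t) + (Λ * ((-S t / ((W t - 1) ^ 2 - S t ^ 2) : ℝ) : ℂ) / 3) * ((Real.exp t : ℂ) * ŵ t)) - (Λ * ((-S t / ((W t - 1) ^ 2 - S t ^ 2) : ℝ) : ℂ) * ((Real.exp t : ℂ) * ŝ t))‖ ^ 2) y ∧ DifferentiableAt ℝ (fun t => ‖(((Real.exp t : ℂ) * ŝ t) + (Λ * ((-S t / ((W t - 1) ^ 2 - S t ^ 2) : ℝ) : ℂ) / 3) * ((Real.exp t : ℂ) * ŵ t)) + (Λ * ((-S t / ((W t - 1) ^ 2 - S t ^ 2) : ℝ) : ℂ) * ((Real.exp t : ℂ) * ŝ t))‖ ^ 2) y ∧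
    deriv (fun t => ‖((Real.exp t : ℂ) * ŵ t)‖ ^ 2 / 9 + ‖((Real.exp t : ℂ) * ŝ t)‖ ^ 2) y ≤ (1122 / 100 * Real.exp y + 21 * Real.exp y ^ 2) * (fun t => ‖((Real.exp t : ℂ) * ŵ t)‖ ^ 2 / 9 + ‖((Real.exp t : ℂ) * ŝ t)‖ ^ 2) y ∧
    deriv (fun t => ‖(((Real.exp t : ℂ) * ŝ t) + (Λ * ((-S t / ((W t - 1) ^ 2 - S t ^ 2) : ℝ) : ℂ) / 3) * ((Real.exp t : ℂ) * ŵ t))‖ ^ 2 + ‖(Λ * ((-S t / ((W t - 1) ^ 2 - S t ^ 2) : ℝ) : ℂ) * ((Real.exp t : ℂ) * ŝ t))‖ ^ 2) y ≤ (1236 / 100 * Real.exp y + 445 / 10 * Real.exp y ^ 2) * (fun t => ‖(((Real.exp t : ℂ) * ŝ t) + (Λ * ((-S t / ((W t - 1) ^ 2 - S t ^ 2) : ℝ) : ℂ) / 3) * ((Real.exp t : ℂ) * ŵ t))‖ ^ 2 + ‖(Λ * ((-S t / ((W t - 1) ^ 2 - S t ^ 2) : ℝ) : ℂ) * ((Real.exp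 t : ℂ) * ŝ t))‖ ^ 2) y + (63 / 10 * Real.exp y + 115 / 10 * Real.exp y ^ 2) * Nb ∧
    deriv (fun t => ‖(((Real.exp t : ℂ) * ŝ t) + (Λ * ((-S t / ((W t - 1) ^ 2 - S t ^ 2) : ℝ) : ℂ) / 3) * ((Real.exp t : ℂ) * ŵ t)) - (Λ * ((-S t / ((W t - 1) ^ 2 - S t ^ 2) : ℝ) : ℂ) * ((Real.exp t : ℂ) * ŝ t))‖ ^ 2) y ≤ (702 / 100 * Real.exp y + 335 / 10 * Real.exp y ^ 2) * (fun t => ‖(((Real.exp t : ℂ) * ŝ t) + (Λ * ((-S t / ((W t - 1) ^ 2 - S t ^ 2) : ℝ) : ℂ) / 3) * ((Real.exp t : ℂ) * ŵ t)) - (Λ * ((-S t / ((W t - 1) ^ 2 - S t ^ 2) : ℝ) : ℂ) * ((Real.exp t : ℂ) * ŝ t))‖ ^ 2) y +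
      (22 * Real.exp y ^ 2 * (fun t => ‖(((Real.exp t : ℂ) * ŝ t) + (Λ * ((-S t / ((W t - 1) ^ 2 - S t ^ 2) : ℝ) : ℂ) / 3) * ((Real.exp t : ℂ) * ŵ t))‖ ^ 2 + ‖(Λ * ((-S t / ((W t - 1) ^ 2 - S t ^ 2) : ℝ) : ℂ) * ((Real.exp t : ℂ) * ŝ t))‖ ^ 2) y + (63 / 10 * Real.exp y + 115 / 10 * Real.exp y ^ 2) * Nb) ∧
    -((702 / 100 * Real.exp y + 2342 / 100 * Real.exp y ^ 2) * (fun t => ‖(((Real.exp t : ℂ) * ŝ t) + (Λ * ((-S t / ((W t - 1) ^ 2 - S t ^ 2) : ℝ) : ℂ) / 3) * ((Real.exp t : ℂ) * ŵ t)) + (Λ * ((-S t / ((W t - 1) ^ 2 - S t ^ 2) : ℝ) : ℂ) * ((Real.exp t : ℂ) * ŝ t))‖ ^ 2) y) -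
      (22 * Real.exp y ^ 2 * (fun t => ‖(((Real.exp t : ℂ) * ŝ t) + (Λ * ((-S t / ((W t - 1) ^ 2 - S t ^ 2) : ℝ) : ℂ) / 3) * ((Real.exp t : ℂ) * ŵ t))‖ ^ 2 + ‖(Λ * ((-S t / ((W t - 1) ^ 2 - S t ^ 2) : ℝ) : ℂ) * ((Real.exp t : ℂ) * ŝ t))‖ ^ 2) y + (63 / 10 * Real.exp y + 115 / 10 * Real.exp y ^ 2) * Nb) ≤ deriv (fun t => ‖(((Real.exp t : ℂ) * ŝ t) + (Λ * ((-S t / ((W t - 1) ^ 2 - S t ^ 2) : ℝ) : ℂ) / 3) * ((Real.exp t : ℂ) * ŵ t)) + (Λ * ((-S t / ((W t - 1) ^ 2 - S t ^ 2) : ℝ) : ℂ) * ((Real.exp t : ℂ) * ŝ t))‖ ^ 2) y := by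
  obtain ⟨Θ, Ev, Ez, A, Bc, Cc, Dc, hU, hS, hv, hz, hEv, hEz, hΘ, hκre, hm, hp, ht₁, ht₂, hAb, hBb, hCb, hDb⟩ :=
    inner_point hr₁ hr₂ hP hT hre₁ hre₂ hy hŵ hŝ hmode
  have hρ : 0 < Real.exp y := Real.exp_pos y
  have hUid : Λ * ((-S y / ((W y - 1) ^ 2 - S y ^ 2) : ℝ) : ℂ) / 3 * ((Real.exp y : ℂ) * ŵ y) = (((Real.exp y : ℂ) * ŝ y) + (Λ * ((-S y / ((W y - 1) ^ 2 - S y ^ 2) : ℝ) : ℂ) / 3) * ((Real.exp y : ℂ) * ŵ y)) - ((Real.exp y : ℂ) * ŝ y) := by ring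
  have dE : HasDerivAt (fun t => ‖(((Real.exp t : ℂ) * ŝ t) + (Λ * ((-S t / ((W t - 1) ^ 2 - S t ^ 2) : ℝ) : ℂ) / 3) * ((Real.exp t : ℂ) * ŵ t))‖ ^ 2 + ‖(Λ * ((-S t / ((W t - 1) ^ 2 - S t ^ 2) : ℝ) : ℂ) * ((Real.exp t : ℂ) * ŝ t))‖ ^ 2) _ y := (hasDerivAt_norm_sq_complex hv).add (hasDerivAt_norm_sq_complex hz)
  have dM : HasDerivAt (fun t => ‖(((Real.exp t : ℂ) * ŝ t) + (Λ * ((-S t / ((W t - 1) ^ 2 - S t ^ 2) : ℝ) : ℂ) / 3) * ((Real.exp t : ℂ) * ŵ t)) - (Λ * ((-S t / ((W t - 1) ^ 2 - S t ^ 2) : ℝ) : ℂ) * ((Real.exp t : ℂ) * ŝ t))‖ ^ 2) _ y := hasDerivAt_norm_sq_complex (hv.sub hz)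
  have dP : HasDerivAt (fun t => ‖(((Real.exp t : ℂ) * ŝ t) + (Λ * ((-S t / ((W t - 1) ^ 2 - S t ^ 2) : ℝ) : ℂ) / 3) * ((Real.exp t : ℂ) * ŵ t)) + (Λ * ((-S t / ((W t - 1) ^ 2 - S t ^ 2) : ℝ) : ℂ) * ((Real.exp t : ℂ) * ŝ t))‖ ^ 2) _ y := hasDerivAt_norm_sq_complex (hv.add hz)
  have aE := dE_alg (((Real.exp y : ℂ) * ŝ y) + (Λ * ((-S y / ((W y - 1) ^ 2 - S y ^ 2) : ℝ) : ℂ) / 3) * ((Real.exp y : ℂ) * ŵ y)) (Λ * ((-S y / ((W y - 1) ^ 2 - S y ^ 2) : ℝ) : ℂ) * ((Real.exp y : ℂ) * ŝ y)) _ _ Θ (Λ * ((-S y / ((W y - 1) ^ 2 - S y ^ 2) : ℝ) : ℂ)) Ev Ez rfl rfl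
  have aM := dEm_alg (((Real.exp y : ℂ) * ŝ y) + (Λ * ((-S y / ((W y - 1) ^ 2 - S y ^ 2) : ℝ) : ℂ) / 3) * ((Real.exp y : ℂ) * ŵ y)) (Λ * ((-S y / ((W y - 1) ^ 2 - S y ^ 2) : ℝ) : ℂ) * ((Real.exp y : ℂ) * ŝ y)) _ _ Θ (Λ * ((-S y / ((W y - 1) ^ 2 - S y ^ 2) : ℝ) : ℂ)) Ev Ez rfl rfl
  have aP := dEp_alg (((Real.exp y : ℂ) * ŝ y) + (Λ * ((-S y / ((W y - 1) ^ 2 - S y ^ 2) : ℝ) : ℂ) / 3) * ((Real.exp y : ℂ) * ŵ y)) (Λ * ((-S y / ((W y - 1) ^ 2 - S y ^ 2) : ℝ) : ℂ) * ((Real.exp y : ℂ) * ŝ y)) _ _ Θ (Λ * ((-S y / ((W y - 1) ^ 2 - S y ^ 2) : ℝ) : ℂ)) Ev Ez rfl rfl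
  have hρ1 : Real.exp y ≤ 1 / 1000 := by
    rw [le_div_iff₀ (by norm_num : (0:ℝ) < 1000)]
    have h1 : Real.exp y * 1000 ≤ Real.exp y * ‖Λ‖ := mul_le_mul_of_nonneg_left hL hρ.le
    linarith
  have ht : ‖Λ * ((-S y / ((W y - 1) ^ 2 - S y ^ 2) : ℝ) : ℂ)‖ ≤ 144 / 100 := by
    refine ht₂.trans ?_
    have h1 : 144 / 100 * Real.exp y * ‖Λ‖ = 144 / 100 * (Real.exp y * ‖Λ‖) := by ring
    rw [h1]
    linarith
  have hN0 : (fun t => ‖((Real.exp t : ℂ) * ŵ t)‖ ^ 2 / 9 + ‖((Real.exp t : ℂ) * ŝ t)‖ ^ 2) y = ‖((Real.exp y : ℂ) * ŵ y)‖ ^ 2 / 9 + ‖((Real.exp y : ℂ) * ŝ y)‖ ^ 2 := rfl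
  rw [hN0] at hNb
  have hUN : ‖((Real.exp y : ℂ) * ŵ y)‖ ^ 2 ≤ 9 * Nb := by
    linarith [sq_nonneg ‖((Real.exp y : ℂ) * ŝ y)‖]
  have hSN : ‖((Real.exp y : ℂ) * ŝ y)‖ ^ 2 ≤ Nb := by
    linarith [sq_nonneg ‖((Real.exp y : ℂ) * ŵ y)‖]
  obtain ⟨iE, iM, iP⟩ := inner_regionI_ineq (((Real.exp y : ℂ) * ŝ y) + (Λ * ((-S y / ((W y - 1) ^ 2 - S y ^ 2) : ℝ) : ℂ) / 3) * ((Real.exp y : ℂ) * ŵ y)) (Λ * ((-S y / ((W y - 1) ^ 2 - S y ^ 2) : ℝ) : ℂ) * ((Real.exp y : ℂ) * ŝ y)) ((Real.exp y : ℂ) * ŵ y) ((Real.exp y : ℂ) * ŝ y) Θ (Λ * ((-S y / ((W y - 1) ^ 2 - S y ^ 2) : ℝ) : ℂ)) Ev Ez (Real.exp y) Nb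
    hρ hρ1 ht hUN hSN hEv hEz hΘ hκre hm hp
  have iN := inner_N_ineq ((Real.exp y : ℂ) * ŵ y) ((Real.exp y : ℂ) * ŝ y) Θ (Λ * ((-S y / ((W y - 1) ^ 2 - S y ^ 2) : ℝ) : ℂ)) A Bc Cc Dc (Real.exp y) hρ hy hAb hBb hCb hDb hΘ hκre
  have dN : HasDerivAt (fun t => ‖((Real.exp t : ℂ) * ŵ t)‖ ^ 2 / 9 + ‖((Real.exp t : ℂ) * ŝ t)‖ ^ 2) _ y := ((hasDerivAt_norm_sq_complex hU).div_const 9).add (hasDerivAt_norm_sq_complex hS)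
  have aN := dN_alg ((Real.exp y : ℂ) * ŵ y) ((Real.exp y : ℂ) * ŝ y) _ _ Θ (Λ * ((-S y / ((W y - 1) ^ 2 - S y ^ 2) : ℝ) : ℂ)) A Bc Cc Dc rfl rfl
  refine ⟨dN.differentiableAt, dE.differentiableAt, dM.differentiableAt, dP.differentiableAt, ?_, ?_, ?_, ?_⟩
  · beta_reduce
    rw [dN.deriv]
    have e1 : 2 * (starRingEnd ℂ ((Real.exp y : ℂ) * ŵ y) * ((Θ - 2 + A) * ((Real.exp y : ℂ) * ŵ y) + (3 * (Λ * ((-S y / ((W y - 1) ^ 2 - S y ^ 2) : ℝ) : ℂ)) + Bc) * ((Real.exp y : ℂ) * ŝ y))).re / 9 =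
        2 / 9 * (starRingEnd ℂ ((Real.exp y : ℂ) * ŵ y) * ((Θ - 2 + A) * ((Real.exp y : ℂ) * ŵ y) + (3 * (Λ * ((-S y / ((W y - 1) ^ 2 - S y ^ 2) : ℝ) : ℂ)) + Bc) * ((Real.exp y : ℂ) * ŝ y))).re := by ring
    rw [e1, aN]
    exact iN
  · beta_reduce; rw [dE.deriv, aE]; exact iE
  · beta_reduce; rw [dM.deriv, aM]; exact iM
  · beta_reduce; rw [dP.deriv, aP]; exact iP

end Summit.AtomisticToContinuum.HydrodynamicLimit.Theorems.SonicCavityRenewal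

end
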